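/-
Copyright: harness cell b2b-lgcu-borel (gen 16).  Honest framing: the VALUE here is a THEOREM
(all primes `p`): the image dichotomy inside the two torus normalisers of `GL₂(𝔽_p)`, which turns
the Dickson hypothesis of `DicksonReduction` into its textbook shape — NOT summit progress; the
crux item `SubgroupIdentityDesigns` (stmt-MatrixMultiplication-14079) stays open and untouched.
-/
import Mathlib
import Summits.MatrixMultiplication.MatrixMultiplication.Theorems.LieRankDesigns.Negative.Basics
import Summits.MatrixMultiplication.MatrixMultiplication.Theorems.SubgroupIdentityDesigns.Negative.DecoratedSylowShapes
import Summits.MatrixMultiplication.MatrixMultiplication.Theorems.SubgroupIdentityDesigns.Negative.ScalarLaw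
import Summits.MatrixMultiplication.MatrixMultiplication.Theorems.SubgroupIdentityDesigns.Negative.ImageCeiling
import Summits.MatrixMultiplication.MatrixMultiplication.Theorems.SubgroupIdentityDesigns.Negative.OnePMemberLaw
import Literature.NumberTheory.EllipticCurves.BinaryQuarticDiscriminantFpCountProofs

/-!
# Image dichotomy inside the torus normalisers of `GL₂(𝔽_p)`

Cell `(m,k) = (2,1)` of the crux `SubgroupIdentityDesigns`, all primes `p ≥ 3`.  The two torus
normalisers are handled by their ENTRY SHAPES, without computing their orders exactly:
* the monomial group `N(T_s)` = `monomialSubgroup p` (`IsMonomial`: diagonal or anti-diagonal);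
* the normaliser `N(C)` of the Singer cycle `C = {x + y√n}` (`n` a non-square) =
  `singerNormalSubgroup n` (`IsSingerNormal n`: shape⁺ `[[x, n y],[y, x]]` or shape⁻
  `[[x, -n y],[y, -x]]`).
Both are obtained from the generic `subgroupOfMulClosed` (a product-closed subset of a finite group
containing `1` is a subgroup) and both inject into `Bool × 𝔽_p × 𝔽_p`, so have order `≤ 2p²`
(`card_monomialSubgroup_le`, `card_singerNormalSubgroup_le`).  Since both contain the scalars `Z`,
their images in `GL₂/Z` have order `≤ 2p²/(p-1)`, i.e. `≤ 2(p+1)` for `p ≥ 3`, and Lagrange gives the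
IMAGE DICHOTOMY `image_le_or_cover`: for `H ≤ K` (`K` either normaliser),
EITHER the projective image `H Z/Z` has order `≤ p + 1`, OR `H Z = K`, i.e. every element of `K` lies
in `H` up to a scalar (`image_le_or_cover_monomial`, `image_le_or_cover_singerNormal`).
The first alternative feeds `ImageCeiling.no_levelOne_witness_of_image_le`; the second feeds
`FullImageSplit.fixers_of_full_split` / `FullImageNonsplit.fixers_of_full_nonsplit` (no free vector).
Finally `card_image_conj`: the order of the projective image is invariant under conjugation
(`H ↦ g H g⁻¹ = H.map (MulAut.conj g)`), so the dichotomy applies to subgroups conjugate INTO a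
normaliser — the form in which Dickson's classification is quoted in `DicksonReduction`
(membership in a conjugate: `OnePMemberLaw.mem_map_conj_iff'`).

Scope, honestly: `m = 2`; pure group theory of `GL₂(𝔽_p)`; nothing here touches the crux, which
stays open.  Report: `run/shared/lean/b2b/levelgraded-cu/ORACLE-g16.md` §G16-1.  Sorry-free.
-/

set_option linter.dupNamespace false

noncomputable section

open scoped BigOperators Classical
open Summit.MatrixMultiplication.MatrixMultiplication.Theorems.LieRankDesigns.Negative (GLm Mat)
open Literature.NumberTheory.EllipticCurves.BinaryQuartic (two_ne_zero_zmod)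

namespace Summit.MatrixMultiplication.MatrixMultiplication.Theorems.SubgroupIdentityDesigns.Negative

section NormaliserImages

/-- In a finite group, a product-closed subset containing `1` is closed under inverses
(`x⁻¹ = x ^ (orderOf x - 1)`). -/
theorem inv_mem_of_mul_closed {G : Type*} [Group G] [Finite G] {S : Set G} (h1 : (1 : G) ∈ S)
    (hmul : ∀ x ∈ S, ∀ y ∈ S, x * y ∈ S) {x : G} (hx : x ∈ S) : x⁻¹ ∈ S := by
  have hpow : ∀ k : ℕ, x ^ k ∈ S := by
    intro k
    induction k with
    | zero => rw [pow_zero]; exact h1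
    | succ k ih => rw [pow_succ]; exact hmul _ ih _ hx
  have h0 : 1 ≤ orderOf x := orderOf_pos x
  have hord : x⁻¹ = x ^ (orderOf x - 1) :=
    inv_eq_of_mul_eq_one_right (by rw [← pow_succ', Nat.sub_add_cancel h0, pow_orderOf_eq_one])
  rw [hord]
  exact hpow _

/-- The subgroup of a finite group with a given product-closed carrier containing `1`. -/
def subgroupOfMulClosed {G : Type*} [Group G] [Finite G] (S : Set G) (h1 : (1 : G) ∈ S)
    (hmul : ∀ x ∈ S, ∀ y ∈ S, x * y ∈ S) : Subgroup G where
  carrier := S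
  one_mem' := h1
  mul_mem' := fun hx hy => hmul _ hx _ hy
  inv_mem' := fun hx => inv_mem_of_mul_closed h1 hmul hx

variable {p : ℕ} [hp : Fact p.Prime]

/-- No row of an invertible `2 × 2` matrix vanishes. -/
theorem row_ne_zero (g : GLm p 2) (i : Fin 2) :
    ¬ ((g : Mat p 2) i 0 = 0 ∧ (g : Mat p 2) i 1 = 0) := by
  rintro ⟨h0, h1⟩
  have h := gl2_mul_apply g g⁻¹ i i
  rw [mul_inv_cancel, h0, h1, zero_mul, zero_mul, add_zero] at h
  have h' : ((1 : GLm p 2) : Mat p 2) i i = 1 := by simp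
  exact one_ne_zero (h'.symm.trans h)

/-- No column of an invertible `2 × 2` matrix vanishes. -/
theorem col_ne_zero (g : GLm p 2) (j : Fin 2) :
    ¬ ((g : Mat p 2) 0 j = 0 ∧ (g : Mat p 2) 1 j = 0) := by
  rintro ⟨h0, h1⟩
  have h := gl2_mul_apply g⁻¹ g j j
  rw [inv_mul_cancel, h0, h1, mul_zero, mul_zero, add_zero] at h
  have h' : ((1 : GLm p 2) : Mat p 2) j j = 1 := by simp
  exact one_ne_zero (h'.symm.trans h)

/-- `a = -a` forces `a = 0` in `𝔽_p`, `p ≠ 2` (`two_ne_zero_zmod` from the Literature library). -/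
theorem eq_zero_of_eq_neg_self (hp2 : p ≠ 2) {a : ZMod p} (h : a = -a) : a = 0 := by
  have h2 : (2 : ZMod p) * a = 0 := by linear_combination h
  exact (mul_eq_zero.mp h2).resolve_left (two_ne_zero_zmod hp2)

/-- A subgroup of `GL₂(𝔽_p)` whose elements are separated by a map into `Bool × 𝔽_p × 𝔽_p` has
order at most `2p²`. -/
theorem card_le_two_mul_sq {K : Subgroup (GLm p 2)} (f : GLm p 2 → Bool × ZMod p × ZMod p)
    (hf : ∀ x ∈ K, ∀ y ∈ K, f x = f y → x = y) : Nat.card K ≤ 2 * p ^ 2 := by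
  have hcard : Nat.card (Bool × ZMod p × ZMod p) = 2 * p ^ 2 := by
    rw [Nat.card_prod, Nat.card_prod, Nat.card_eq_fintype_card (α := Bool), Fintype.card_bool,
      Nat.card_zmod]
    ring
  rw [← hcard]
  exact Nat.card_le_card_of_injective (fun x : K => f x)
    (fun x y hxy => Subtype.ext (hf x x.2 y y.2 hxy))

/-! ## The monomial group `N(T_s)` -/

/-- `g` is MONOMIAL: diagonal or anti-diagonal (the elements of the normaliser of the diagonal
torus). -/
def IsMonomial (g : GLm p 2) : Prop :=
  ((g : Mat p 2) 0 1 = 0 ∧ (g : Mat p 2) 1 0 = 0) ∨ ((g : Mat p 2) 0 0 = 0 ∧ (g : Mat p 2) 1 1 = 0)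

/-- `1` is monomial. -/
theorem isMonomial_one : IsMonomial (1 : GLm p 2) :=
  Or.inl ⟨gl2_one_apply.2.1, gl2_one_apply.2.2.1⟩

/-- Products of monomial matrices are monomial. -/
theorem isMonomial_mul {g h : GLm p 2} (hg : IsMonomial g) (hh : IsMonomial h) :
    IsMonomial (g * h) := by
  unfold IsMonomial at *
  rcases hg with ⟨g01, g10⟩ | ⟨g00, g11⟩ <;> rcases hh with ⟨h01, h10⟩ | ⟨h00, h11⟩
  · left; constructor <;> rw [gl2_mul_apply] <;> simp [g01, g10, h01, h10]
  · right; constructor <;> rw [gl2_mul_apply] <;> simp [g01, g10, h00, h11]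
  · right; constructor <;> rw [gl2_mul_apply] <;> simp [g00, g11, h01, h10]
  · left; constructor <;> rw [gl2_mul_apply] <;> simp [g00, g11, h00, h11]

/-- The MONOMIAL GROUP `N(T_s) ≤ GL₂(𝔽_p)`. -/
def monomialSubgroup (p : ℕ) [Fact p.Prime] : Subgroup (GLm p 2) :=
  subgroupOfMulClosed {g : GLm p 2 | IsMonomial g} isMonomial_one
    (fun _ hx _ hy => isMonomial_mul hx hy)

/-- Membership in the monomial group is the entry condition. -/
theorem mem_monomialSubgroup {g : GLm p 2} :
    g ∈ monomialSubgroup p ↔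
      ((g : Mat p 2) 0 1 = 0 ∧ (g : Mat p 2) 1 0 = 0) ∨
        ((g : Mat p 2) 0 0 = 0 ∧ (g : Mat p 2) 1 1 = 0) :=
  Iff.rfl

/-- Scalars are monomial. -/
theorem range_scalarHom_le_monomial : (scalarHom p 2).range ≤ monomialSubgroup p := by
  rintro _ ⟨u, rfl⟩
  rw [mem_monomialSubgroup]
  left
  constructor <;> simp [coe_scalarHom, Matrix.scalar_apply]

/-- `|N(T_s)| ≤ 2p²` (injection `g ↦ (g₀₁ = 0 ?, g₀₀ + g₀₁, g₁₀ + g₁₁)`; the true order is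
`2(p-1)²`). -/
theorem card_monomialSubgroup_le : Nat.card (monomialSubgroup p) ≤ 2 * p ^ 2 := by
  refine card_le_two_mul_sq
    (fun g => (decide ((g : Mat p 2) 0 1 = 0), (g : Mat p 2) 0 0 + (g : Mat p 2) 0 1,
      (g : Mat p 2) 1 0 + (g : Mat p 2) 1 1)) ?_
  intro x hx y hy hxy
  simp only [Prod.mk.injEq, decide_eq_decide] at hxy
  obtain ⟨hd, hs0, hs1⟩ := hxy
  rcases mem_monomialSubgroup.mp hx with ⟨x01, x10⟩ | ⟨x00, x11⟩ <;>
    rcases mem_monomialSubgroup.mp hy with ⟨y01, y10⟩ | ⟨y00, y11⟩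
  · rw [x01, y01, add_zero, add_zero] at hs0
    rw [x10, y10, zero_add, zero_add] at hs1
    exact gl2_ext hs0 (by rw [x01, y01]) (by rw [x10, y10]) hs1
  · exact absurd ⟨y00, hd.mp x01⟩ (row_ne_zero y 0)
  · exact absurd ⟨x00, hd.mpr y01⟩ (row_ne_zero x 0)
  · rw [x00, y00, zero_add, zero_add] at hs0
    rw [x11, y11, add_zero, add_zero] at hs1
    exact gl2_ext (by rw [x00, y00]) hs0 hs1 (by rw [x11, y11])

/-! ## The normaliser of the Singer cycle -/

/-- `g` lies in the normaliser of the Singer cycle `{x + y√n}`: shape⁺ `[[x, n y],[y, x]]`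
(the cycle itself, an element of `𝔽_p(√n)ˣ`) or shape⁻ `[[x, -n y],[y, -x]]` (its Galois coset). -/
def IsSingerNormal (n : ZMod p) (g : GLm p 2) : Prop :=
  ((g : Mat p 2) 0 1 = n * (g : Mat p 2) 1 0 ∧ (g : Mat p 2) 1 1 = (g : Mat p 2) 0 0) ∨
    ((g : Mat p 2) 0 1 = -(n * (g : Mat p 2) 1 0) ∧ (g : Mat p 2) 1 1 = -(g : Mat p 2) 0 0)

/-- `1` has shape⁺. -/
theorem isSingerNormal_one (n : ZMod p) : IsSingerNormal n (1 : GLm p 2) :=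
  Or.inl ⟨by rw [gl2_one_apply.2.1, gl2_one_apply.2.2.1, mul_zero],
    by rw [gl2_one_apply.1, gl2_one_apply.2.2.2]⟩

/-- Products: `(±)(±) = (+)`, `(±)(∓) = (-)`. -/
theorem isSingerNormal_mul {n : ZMod p} {g h : GLm p 2} (hg : IsSingerNormal n g)
    (hh : IsSingerNormal n h) : IsSingerNormal n (g * h) := by
  unfold IsSingerNormal at *
  rcases hg with ⟨g01, g11⟩ | ⟨g01, g11⟩ <;> rcases hh with ⟨h01, h11⟩ | ⟨h01, h11⟩
  · left; constructor <;> simp only [gl2_mul_apply, g01, g11, h01, h11] <;> ring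
  · right; constructor <;> simp only [gl2_mul_apply, g01, g11, h01, h11] <;> ring
  · right; constructor <;> simp only [gl2_mul_apply, g01, g11, h01, h11] <;> ring
  · left; constructor <;> simp only [gl2_mul_apply, g01, g11, h01, h11] <;> ring

/-- The NORMALISER OF THE SINGER CYCLE `N(C) ≤ GL₂(𝔽_p)` (for the parameter `n`). -/
def singerNormalSubgroup (n : ZMod p) : Subgroup (GLm p 2) :=
  subgroupOfMulClosed {g : GLm p 2 | IsSingerNormal n g} (isSingerNormal_one n)
    (fun _ hx _ hy => isSingerNormal_mul hx hy)

/-- Membership in `N(C)` is the shape condition. -/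
theorem mem_singerNormalSubgroup {n : ZMod p} {g : GLm p 2} :
    g ∈ singerNormalSubgroup n ↔
      ((g : Mat p 2) 0 1 = n * (g : Mat p 2) 1 0 ∧ (g : Mat p 2) 1 1 = (g : Mat p 2) 0 0) ∨
        ((g : Mat p 2) 0 1 = -(n * (g : Mat p 2) 1 0) ∧ (g : Mat p 2) 1 1 = -(g : Mat p 2) 0 0) :=
  Iff.rfl

/-- Scalars have shape⁺. -/
theorem range_scalarHom_le_singerNormal (n : ZMod p) :
    (scalarHom p 2).range ≤ singerNormalSubgroup n := by
  rintro _ ⟨u, rfl⟩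
  rw [mem_singerNormalSubgroup]
  left
  constructor <;> simp [coe_scalarHom, Matrix.scalar_apply]

/-- `|N(C)| ≤ 2p²` for `p ≠ 2`, `n ≠ 0` (injection `g ↦ (shape⁺ ?, g₀₀, g₁₀)`; the true order is
`2(p²-1)`). -/
theorem card_singerNormalSubgroup_le (hp2 : p ≠ 2) {n : ZMod p} (hn0 : n ≠ 0) :
    Nat.card (singerNormalSubgroup n) ≤ 2 * p ^ 2 := by
  refine card_le_two_mul_sq
    (fun g => (decide ((g : Mat p 2) 0 1 = n * (g : Mat p 2) 1 0 ∧
        (g : Mat p 2) 1 1 = (g : Mat p 2) 0 0), (g : Mat p 2) 0 0, (g : Mat p 2) 1 0)) ?_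
  -- an element of both shapes would have a vanishing first column
  have key : ∀ y : GLm p 2,
      ((y : Mat p 2) 0 1 = n * (y : Mat p 2) 1 0 ∧ (y : Mat p 2) 1 1 = (y : Mat p 2) 0 0) →
      ((y : Mat p 2) 0 1 = -(n * (y : Mat p 2) 1 0) ∧ (y : Mat p 2) 1 1 = -(y : Mat p 2) 0 0) →
      False := by
    intro y hpos hneg
    have e00 : (y : Mat p 2) 0 0 = 0 :=
      eq_zero_of_eq_neg_self hp2 (hpos.2.symm.trans hneg.2)
    have e10' : n * (y : Mat p 2) 1 0 = 0 :=
      eq_zero_of_eq_neg_self hp2 (hpos.1.symm.trans hneg.1)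
    have e10 : (y : Mat p 2) 1 0 = 0 := (mul_eq_zero.mp e10').resolve_left hn0
    exact col_ne_zero y 0 ⟨e00, e10⟩
  intro x hx y hy hxy
  simp only [Prod.mk.injEq, decide_eq_decide] at hxy
  obtain ⟨hd, h00, h10⟩ := hxy
  rcases mem_singerNormalSubgroup.mp hx with ⟨x01, x11⟩ | ⟨x01, x11⟩ <;>
    rcases mem_singerNormalSubgroup.mp hy with ⟨y01, y11⟩ | ⟨y01, y11⟩
  · exact gl2_ext h00 (by rw [x01, y01, h10]) h10 (by rw [x11, y11, h00])
  · exact (key y (hd.mp ⟨x01, x11⟩) ⟨y01, y11⟩).elim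
  · exact (key x (hd.mpr ⟨y01, y11⟩) ⟨x01, x11⟩).elim
  · exact gl2_ext h00 (by rw [x01, y01, h10]) h10 (by rw [x11, y11, h00])

/-! ## The image dichotomy -/

/-- IMAGE DICHOTOMY.  Let `Z ≤ K ≤ GL₂(𝔽_p)` with `|K| ≤ 2p²`, `p ≥ 3`, and `H ≤ K`.  Then either
the projective image `H Z/Z` has order `≤ p + 1`, or `H Z = K`: every element of `K` lies in `H` up
to a scalar.  (Lagrange in `K Z/Z`, whose order is `≤ 2p²/(p-1) ≤ 2p + 3`.) -/
theorem image_le_or_cover (hp3 : 3 ≤ p) {H K : Subgroup (GLm p 2)} (hHK : H ≤ K)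
    (hZK : (scalarHom p 2).range ≤ K) (hK : Nat.card K ≤ 2 * p ^ 2) :
    Nat.card (H.map (QuotientGroup.mk' (scalarHom p 2).range)) ≤ p + 1 ∨
      ∀ m ∈ K, ∃ u : (ZMod p)ˣ, m * scalarHom p 2 u ∈ H := by
  classical
  by_cases hfull : ∀ m ∈ K, ∃ u : (ZMod p)ˣ, m * scalarHom p 2 u ∈ H
  · exact Or.inr hfull
  left
  simp only [not_forall, not_exists] at hfull
  obtain ⟨m, hmK, hm⟩ := hfull
  set Z := (scalarHom p 2).range with hZ
  set π := QuotientGroup.mk' Z with hπ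
  have hle : H.map π ≤ K.map π := Subgroup.map_mono hHK
  have hne : H.map π ≠ K.map π := by
    intro heq
    have hmem : π m ∈ H.map π := by rw [heq]; exact Subgroup.mem_map_of_mem π hmK
    obtain ⟨h, hh, hπh⟩ := Subgroup.mem_map.mp hmem
    rw [hπ, QuotientGroup.mk'_apply, QuotientGroup.mk'_apply] at hπh
    obtain ⟨v, hv⟩ := MonoidHom.mem_range.mp (QuotientGroup.eq.mp hπh)
    apply hm v⁻¹
    have e : m * scalarHom p 2 v⁻¹ = h := by
      rw [map_inv, hv]; group
    rw [e]; exact hh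
  have hlt : Nat.card (H.map π) < Nat.card (K.map π) := by
    by_contra hge
    exact hne (Subgroup.eq_of_le_of_card_ge hle (not_lt.mp hge))
  obtain ⟨q, hq⟩ := Subgroup.card_dvd_of_le hle
  have hKπ : Nat.card (K.map π) ≤ 2 * p ^ 2 / (p - 1) :=
    (card_map_mk_le_div le_rfl hZK).trans (Nat.div_le_div_right hK)
  have hpos : 0 < p - 1 := by omega
  have hmul : Nat.card (K.map π) * (p - 1) ≤ 2 * p ^ 2 := (Nat.le_div_iff_mul_le hpos).mp hKπ
  obtain ⟨r, hr⟩ : ∃ r, p = 3 + r := Nat.exists_eq_add_of_le hp3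
  have hsub : p - 1 = r + 2 := by omega
  rw [hsub] at hmul
  rw [hq] at hlt hmul
  set d := Nat.card (H.map π) with hd
  have hq2 : 2 ≤ q := by
    by_contra hq1
    have hq1' := not_le.mp hq1
    interval_cases q
    · simp at hlt
    · simp at hlt
  by_contra hbig
  have hbig' := not_le.mp hbig
  have h1 : (r + 5) * 2 * (r + 2) ≤ d * q * (r + 2) := by
    apply Nat.mul_le_mul_right
    calc (r + 5) * 2 ≤ d * 2 := by omega
      _ ≤ d * q := Nat.mul_le_mul_left d hq2
  have h2 : (r + 5) * 2 * (r + 2) ≤ 2 * p ^ 2 := h1.trans hmul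
  rw [hr] at h2
  nlinarith [h2]

/-- Dichotomy for subgroups of the monomial group (`p ≥ 3`). -/
theorem image_le_or_cover_monomial (hp3 : 3 ≤ p) {H : Subgroup (GLm p 2)}
    (hH : ∀ h ∈ H, IsMonomial h) :
    Nat.card (H.map (QuotientGroup.mk' (scalarHom p 2).range)) ≤ p + 1 ∨
      ∀ m : GLm p 2, IsMonomial m → ∃ u : (ZMod p)ˣ, m * scalarHom p 2 u ∈ H := by
  rcases image_le_or_cover hp3 (K := monomialSubgroup p) (fun h hh => hH h hh)
      range_scalarHom_le_monomial card_monomialSubgroup_le with hle | hcov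
  · exact Or.inl hle
  · exact Or.inr fun m hm => hcov m hm

/-- Dichotomy for subgroups of the Singer-cycle normaliser (`p ≥ 3`, `n ≠ 0`). -/
theorem image_le_or_cover_singerNormal (hp3 : 3 ≤ p) {n : ZMod p} (hn0 : n ≠ 0)
    {H : Subgroup (GLm p 2)} (hH : ∀ h ∈ H, IsSingerNormal n h) :
    Nat.card (H.map (QuotientGroup.mk' (scalarHom p 2).range)) ≤ p + 1 ∨
      ∀ m : GLm p 2, IsSingerNormal n m → ∃ u : (ZMod p)ˣ, m * scalarHom p 2 u ∈ H := by
  have hp2 : p ≠ 2 := by omega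
  rcases image_le_or_cover hp3 (K := singerNormalSubgroup n) (fun h hh => hH h hh)
      (range_scalarHom_le_singerNormal n) (card_singerNormalSubgroup_le hp2 hn0) with hle | hcov
  · exact Or.inl hle
  · exact Or.inr fun m hm => hcov m hm

/-! ## Conjugation invariance of the image order -/

/-- The order of the projective image `H Z/Z` is invariant under conjugation `H ↦ g H g⁻¹`. -/
theorem card_image_conj (H : Subgroup (GLm p 2)) (g : GLm p 2) :
    Nat.card ((H.map (MulAut.conj g).toMonoidHom).map (QuotientGroup.mk' (scalarHom p 2).range)) =
      Nat.card (H.map (QuotientGroup.mk' (scalarHom p 2).range)) := by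
  set π := QuotientGroup.mk' (scalarHom p 2).range with hπ
  have hcomp : π.comp (MulAut.conj g).toMonoidHom = (MulAut.conj (π g)).toMonoidHom.comp π := by
    ext x
    simp [MulAut.conj_apply, map_mul, map_inv]
  rw [Subgroup.map_map, hcomp, ← Subgroup.map_map]
  exact Nat.card_congr
    ((H.map π).equivMapOfInjective (MulAut.conj (π g)).toMonoidHom
      (MulAut.conj (π g)).injective).toEquiv.symm

end NormaliserImages

end Summit.MatrixMultiplication.MatrixMultiplication.Theorems.SubgroupIdentityDesigns.Negative
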